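import Summits.BirchSwinnertonDyer.BirchSwinnertonDyer.Theorems.AdditiveKolyvaginRoadRamifiedHabitatSignLawAnyLevel
import Summits.BirchSwinnertonDyer.BirchSwinnertonDyer.Theorems.AdditiveKolyvaginRoadRamifiedHabitatSignLawInert
import HarnessLib

/-!
# Route `AdditiveKolyvaginRoad`, crux KS′ `LevelKolyvaginSystemsAdditive` (stmt-BirchSwinnertonDyer-21396), card `ramified-toric-habitat` —
# ONE multiplicative prime INERT flips the sign (the Shimura-curve habitat `X^{pq₀}` of the rank-one rows), for ARBITRARY reduction off `p`

Cell `pub/bsd-wall`, width seat `bsd-wall-akr-p2x-w2` g12; `--supports stmt-BirchSwinnertonDyer-21396` (helper). THEOREMS ONLY; no definition,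
no named fact, no `sorry`. BSD is not proved by any of this; KS′/KPA′ stay OPEN at `p² ∣ N`.

g11's part 7 (`…RamifiedHabitatSignLawInert`): in the `p`-ramified habitat, making ONE odd prime `q₀ ∣ M` INERT instead of split flips
`w(E)·w(E^{(d)})` (card T3 / PART A col. 3) — for `M` squarefree. Here for ANY `M` prime to `p`, with the inert prime `q₀` occurring to an ODD power in
`M` (e.g. a MULTIPLICATIVE prime of `E`, `v_{q₀}(N) = 1` — the ♯ frames of the crux have two of them): `(M/|d'|) = −(M/p)`
(`jacobiSym_natAbs_eq_neg_legendreSym_of_one_inert_anyLevel`), hence with the general-level assembly of `…SignLawAnyLevel`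
(`rootNumber_mul_rootNumber_pStarTwist_of_localData_anyLevel`):

* `rootNumber_mul_rootNumber_ramifiedTwist_of_localData_of_one_inert_anyLevel` — `w(E)·w(E^{(d)}) = +(−1/p)·r` from the local data at `p`;
* `rootNumber_mul_rootNumber_ramifiedTwist_of_one_inert_anyLevel_eq_neg_one_of_not_dvd` (supercuspidal ⟹ `−1`: the rank-one rows' habitat is
  the Shimura curve `X^{pq₀}`) and `…_eq_one_of_dvd` (potentially good principal series ⟹ `+1`), on all six types II/III/IV/IV*/III*/II*.

CONDITIONAL on the Modularity Theorem and Kellock–Dokchitser's Rem. 2.2 at `p` for `E`, `E^{(p*)}` (named facts). BSD is not proved by this.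

References: [cite: MurtyMurty1997, Ch. 6 §1] [cite: Rohrlich1993Compositio, Prop. 2(iv)] [cite: KellockDokchitser2023, Rem. 2.2] [cite: ShemanskeWalling1993, Prop. 5.4].
-/

set_option autoImplicit false
set_option linter.dupNamespace false

noncomputable section

open scoped Classical MatrixGroups NumberTheorySymbols

open CongruenceSubgroup IsDedekindDomain IsDedekindDomain.HeightOneSpectrum NumberField Rat.HeightOneSpectrum
  WeierstrassCurve Literature.NumberTheory.EllipticCurves Literature.NumberTheory.EllipticCurves.ModularForms
  IsDiscreteValuationRing

namespace Summit.BirchSwinnertonDyer.BirchSwinnertonDyer.Theorems.AdditiveKoly.RamifiedHabitat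

section Inert

variable {p : ℕ} [Fact p.Prime]

/-- `(M / |d'|) = −(M/p)` for ANY `M ≠ 0` when exactly ONE odd prime `q₀ ∣ M`, occurring to an ODD power in `M`, is INERT in `ℚ(√d)` (`d = p*·d'`)
and every other prime of `M` splits (prime by prime on `M = ∏ q^{v_q(M)}`; `(q₀/|d'|) = −(q₀/p)`, g11's `jacobiSym_natAbs_eq_neg_legendreSym_of_inert`).
[folklore] -/
theorem jacobiSym_natAbs_eq_neg_legendreSym_of_one_inert_anyLevel (hp2 : p ≠ 2) {d' : ℤ} (hd'4 : d' % 4 = 1) {M : ℕ} (hM0 : M ≠ 0)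
    {q₀ : ℕ} (hq₀ : q₀ ∈ M.primeFactors) (hq₀2 : q₀ ≠ 2) (hodd₀ : Odd (M.factorization q₀))
    (hinert : J((-1 : ℤ) ^ (p / 2) * p * d' | q₀) = -1)
    (hodd : ∀ q ∈ M.primeFactors, q ≠ q₀ → q ≠ 2 → J((-1 : ℤ) ^ (p / 2) * p * d' | q) = 1)
    (htwo : 2 ∣ M → ((-1 : ℤ) ^ (p / 2) * p * d') % 8 = 1) :
    J((M : ℤ) | d'.natAbs) = -legendreSym p M := by
  let φ : ℤ →* ℤ :=
    { toFun := fun a ↦ jacobiSym a d'.natAbs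
      map_one' := jacobiSym.one_left _
      map_mul' := fun a b ↦ jacobiSym.mul_left a b _ }
  have hφ : ∀ a : ℤ, φ a = J(a | d'.natAbs) := fun _ ↦ rfl
  conv_lhs => rw [Nat.prod_primeFactors_pow_factorization hM0, Nat.cast_prod, ← hφ, map_prod, ← Finset.mul_prod_erase _ _ hq₀]
  conv_rhs => rw [Nat.prod_primeFactors_pow_factorization hM0, Nat.cast_prod, ← legendreSym.hom_apply, map_prod,
    ← Finset.mul_prod_erase _ _ hq₀]
  haveI := Fact.mk (Nat.prime_of_mem_primeFactors hq₀)
  rw [Nat.cast_pow, map_pow, map_pow, hφ, legendreSym.hom_apply, jacobiSym_natAbs_eq_neg_legendreSym_of_inert hp2 hd'4 hq₀2 hinert,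
    hodd₀.neg_pow, neg_mul]
  congr 2
  refine Finset.prod_congr rfl fun q hq ↦ ?_
  have hqq₀ : q ≠ q₀ := Finset.ne_of_mem_erase hq
  have hqM : q ∈ M.primeFactors := Finset.mem_of_mem_erase hq
  rw [Nat.cast_pow, map_pow, map_pow, hφ, legendreSym.hom_apply]
  congr 1
  haveI := Fact.mk (Nat.prime_of_mem_primeFactors hqM)
  by_cases hq2 : q = 2
  · subst hq2
    exact jacobiSym_two_natAbs_eq_legendreSym_of_split hp2 hd'4 (htwo (Nat.dvd_of_mem_primeFactors hqM))
  · exact jacobiSym_natAbs_eq_legendreSym_of_split_odd hp2 hd'4 hq2 (hodd q hqM hqq₀ hq2)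

/-- **ONE INERT PRIME FLIPS THE SIGN, ANY `M`.** Local data at `p` as hypotheses (`W_p(E)·W_p(E^{(p*)}) = r`, both minimal models additive);
habitat `d = p*·d'` (`d' ≡ 1 (4)` squarefree, prime to `N`, `d < 0`) in which exactly one odd prime `q₀ ∣ M` of ODD exponent is INERT and every other
prime of `M` splits: then `w(E)·w(E^{(d)}) = +(−1/p)·r` — the opposite of the all-split habitat (card T3: the Shimura curve `X^{pq₀}` for the
rank-one rows). `N = M·p²`, `p ≥ 5`, `p ∤ M`, NO further hypothesis on `M`. Conditional on {hmod, F1 at `p`}.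
[cite: MurtyMurty1997, Ch. 6 §1] [cite: KellockDokchitser2023, Rem. 2.2] -/
theorem rootNumber_mul_rootNumber_ramifiedTwist_of_localData_of_one_inert_anyLevel (W : WeierstrassCurve ℚ) [W.IsElliptic]
    (hmod : exists_isNewformOf) (hF1 : W.atkinLehnerEigenvalueAt_eq_localRootNumberAt)
    (hF1' : (W.quadraticTwist (((-1 : ℤ) ^ (p / 2) * p : ℤ) : ℚ)).atkinLehnerEigenvalueAt_eq_localRootNumberAt)
    (hp5 : 5 ≤ p) {M : ℕ} (hN : W.conductorNorm ℤ = M * p ^ 2) (hpM : ¬ p ∣ M)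
    (hadd : ((W.baseChange ℚ_[p]).minimal ℤ_[p]).HasAdditiveReduction ℤ_[p])
    (hadd' : (((W.quadraticTwist (((-1 : ℤ) ^ (p / 2) * p : ℤ) : ℚ)).baseChange ℚ_[p]).minimal
      ℤ_[p]).HasAdditiveReduction ℤ_[p]) {r : ℤ}
    (hprod : (W.baseChange ℚ_[p]).localRootNumber ℤ_[p] *
      ((W.quadraticTwist (((-1 : ℤ) ^ (p / 2) * p : ℤ) : ℚ)).baseChange ℚ_[p]).localRootNumber ℤ_[p] = r)
    {d' : ℤ} (hd'4 : d' % 4 = 1) (hd'sq : Squarefree d') (hgcd : Int.gcd d' (W.conductorNorm ℤ) = 1)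
    (hneg : (-1 : ℤ) ^ (p / 2) * p * d' < 0)
    {q₀ : ℕ} (hq₀ : q₀ ∈ M.primeFactors) (hq₀2 : q₀ ≠ 2) (hodd₀ : Odd (M.factorization q₀))
    (hinert : J((-1 : ℤ) ^ (p / 2) * p * d' | q₀) = -1)
    (hodd : ∀ q ∈ M.primeFactors, q ≠ q₀ → q ≠ 2 → J((-1 : ℤ) ^ (p / 2) * p * d' | q) = 1)
    (htwo : 2 ∣ M → ((-1 : ℤ) ^ (p / 2) * p * d') % 8 = 1) :
    W.rootNumber * (W.quadraticTwist (((-1 : ℤ) ^ (p / 2) * p * d' : ℤ) : ℚ)).rootNumber = ZMod.χ₄ p * r := by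
  have hp : p.Prime := Fact.out
  have hp2 : p ≠ 2 := by omega
  have hdZ0 : ((-1 : ℤ) ^ (p / 2) * p : ℤ) ≠ 0 :=
    mul_ne_zero (pow_ne_zero _ (by norm_num)) (by exact_mod_cast hp.ne_zero)
  have hd0 : (((((-1 : ℤ) ^ (p / 2) * p : ℤ)) : ℚ)) ≠ 0 := by exact_mod_cast hdZ0
  haveI hE' : (W.quadraticTwist (((-1 : ℤ) ^ (p / 2) * p : ℤ) : ℚ)).IsElliptic := W.isElliptic_quadraticTwist hd0
  have hM0 : M ≠ 0 := by
    intro h; rw [h, zero_mul] at hN; exact (W.conductorNorm_pos_holds).ne' hN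
  have hA := rootNumber_mul_rootNumber_pStarTwist_of_localData_anyLevel W hmod hF1 hF1' hp5 hN hpM hadd hadd' hprod
  have hN' : (W.quadraticTwist (((-1 : ℤ) ^ (p / 2) * p : ℤ) : ℚ)).conductorNorm ℤ = M * p ^ 2 :=
    (conductorNorm_pStarTwist_eq W hp5 hadd hadd').trans hN
  have hgcd' : Int.gcd d' ((W.quadraticTwist (((-1 : ℤ) ^ (p / 2) * p : ℤ) : ℚ)).conductorNorm ℤ) = 1 := by
    rw [hN', ← hN]; exact hgcd
  have hB := ((W.quadraticTwist (((-1 : ℤ) ^ (p / 2) * p : ℤ) : ℚ)).rootNumber_quadraticTwist_of_emod_four_eq_one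
    hmod hd'4 hd'sq hgcd').1
  rw [quadraticTwist_quadraticTwist, hN'] at hB
  have hcast : ((((-1 : ℤ) ^ (p / 2) * p : ℤ) : ℚ)) * (d' : ℚ) = (((-1 : ℤ) ^ (p / 2) * p * d' : ℤ) : ℚ) := by push_cast; ring
  rw [hcast] at hB
  have hNe0 : NeZero d'.natAbs := ⟨Int.natAbs_ne_zero.mpr (by rintro rfl; norm_num at hd'4)⟩
  have hJM : J(((M * p ^ 2 : ℕ) : ℤ) | d'.natAbs) = -legendreSym p M := by
    rw [Nat.cast_mul, jacobiSym.mul_left,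
      jacobiSym_natAbs_eq_neg_legendreSym_of_one_inert_anyLevel hp2 hd'4 hM0 hq₀ hq₀2 hodd₀ hinert hodd htwo, Nat.cast_pow,
      jacobiSym.sq_one', mul_one]
    rw [Int.gcd_natCast_natCast]
    have h1 : Nat.Coprime d'.natAbs (W.conductorNorm ℤ) := by
      have := hgcd; unfold Int.gcd at this; simpa using this
    have hpN : p ∣ W.conductorNorm ℤ := by rw [hN]; exact ⟨M * p, by ring⟩
    exact (Nat.Coprime.coprime_dvd_right hpN h1).symm
  have hJ1 := jacobiSym_neg_one_natAbs_eq_of_neg hp2 hd'4 hneg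
  have hM2 : legendreSym p M * legendreSym p M = 1 := by
    rw [← sq]
    refine legendreSym.sq_one p ?_
    rw [Int.cast_natCast, ne_eq, ZMod.natCast_eq_zero_iff]
    exact hpM
  calc W.rootNumber * (W.quadraticTwist (((-1 : ℤ) ^ (p / 2) * p * d' : ℤ) : ℚ)).rootNumber
      = J(-1 | d'.natAbs) * J(((M * p ^ 2 : ℕ) : ℤ) | d'.natAbs) *
          (W.rootNumber * (W.quadraticTwist (((-1 : ℤ) ^ (p / 2) * p : ℤ) : ℚ)).rootNumber) := by rw [hB]; ring
    _ = -ZMod.χ₄ p * (-legendreSym p M) * (legendreSym p M * r) := by rw [hJ1, hJM, hA]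
    _ = ZMod.χ₄ p * r := by linear_combination (ZMod.χ₄ ↑p * r) * hM2

/-- **SHIMURA-CURVE HABITAT, ANY `M`: supercuspidal type, ONE multiplicative prime inert ⟹ sign `−1`.** `E/ℚ` of conductor `N = M p²` (`p ≥ 5`,
`p ∤ M`, NO further hypothesis on `M`), additive potentially good at `p` of type II/III/IV/IV*/III*/II* (`a = ord_p Δ_min`, `e = 12/gcd(a,12)`),
`e ∤ p − 1`; `d = p*·d'` odd with `p` ramified, exactly one odd `q₀ ∣ M` of odd exponent inert, all other primes of `M` split. Then
`w(E)·w(E^{(d)}) = −1` (card T3: the habitat of the rank-one rows is `X^{pq₀}`). Conditional on {hmod, F1 at `p`}; BSD is not proved by this.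
[cite: Rohrlich1993Compositio, Prop. 2(iv)] [cite: KellockDokchitser2023, Rem. 2.2] -/
theorem rootNumber_mul_rootNumber_ramifiedTwist_of_one_inert_anyLevel_eq_neg_one_of_not_dvd (W : WeierstrassCurve ℚ) [W.IsElliptic]
    (hmod : exists_isNewformOf) (hF1 : W.atkinLehnerEigenvalueAt_eq_localRootNumberAt)
    (hF1' : (W.quadraticTwist (((-1 : ℤ) ^ (p / 2) * p : ℤ) : ℚ)).atkinLehnerEigenvalueAt_eq_localRootNumberAt)
    (hp5 : 5 ≤ p) {M : ℕ} (hN : W.conductorNorm ℤ = M * p ^ 2) (hpM : ¬ p ∣ M) {a : ℕ}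
    (hΔ : addVal ℤ_[p] (((W.baseChange ℚ_[p]).minimal ℤ_[p]).integralModel ℤ_[p]).Δ = a)
    (ha : a = 2 ∨ a = 3 ∨ a = 4 ∨ a = 8 ∨ a = 9 ∨ a = 10)
    (hc₄ : addVal ℤ_[p] (((W.baseChange ℚ_[p]).minimal ℤ_[p]).integralModel ℤ_[p]).c₄ ≠ 0)
    (hj : ¬ 3 * addVal ℤ_[p] (((W.baseChange ℚ_[p]).minimal ℤ_[p]).integralModel ℤ_[p]).c₄ <
      addVal ℤ_[p] (((W.baseChange ℚ_[p]).minimal ℤ_[p]).integralModel ℤ_[p]).Δ)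
    {d' : ℤ} (hd'4 : d' % 4 = 1) (hd'sq : Squarefree d') (hgcd : Int.gcd d' (W.conductorNorm ℤ) = 1)
    (hneg : (-1 : ℤ) ^ (p / 2) * p * d' < 0)
    {q₀ : ℕ} (hq₀ : q₀ ∈ M.primeFactors) (hq₀2 : q₀ ≠ 2) (hodd₀ : Odd (M.factorization q₀))
    (hinert : J((-1 : ℤ) ^ (p / 2) * p * d' | q₀) = -1)
    (hodd : ∀ q ∈ M.primeFactors, q ≠ q₀ → q ≠ 2 → J((-1 : ℤ) ^ (p / 2) * p * d' | q) = 1)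
    (htwo : 2 ∣ M → ((-1 : ℤ) ^ (p / 2) * p * d') % 8 = 1)
    (hsc : ¬ 12 / Nat.gcd a 12 ∣ p - 1) :
    W.rootNumber * (W.quadraticTwist (((-1 : ℤ) ^ (p / 2) * p * d' : ℤ) : ℚ)).rootNumber = -1 := by
  have hp2 : p ≠ 2 := by omega
  obtain ⟨hadd, hadd', hprod⟩ := localRootNumber_mul_pStarTwist_padic_of_mem W hp5 hΔ ha hc₄ hj
  rw [rootNumber_mul_rootNumber_ramifiedTwist_of_localData_of_one_inert_anyLevel W hmod hF1 hF1' hp5 hN hpM hadd hadd' hprod hd'4 hd'sq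
    hgcd hneg hq₀ hq₀2 hodd₀ hinert hodd htwo]
  have hp' := (Nat.Prime.eq_two_or_odd (Fact.out : p.Prime)).resolve_left hp2
  have hχ₄ := χ₄_mul_self_of_ne_two (p := p) hp2
  by_cases h6 : a % 6 = 3
  · have e4 : 12 / Nat.gcd a 12 = 4 := by
      rcases ha with rfl | rfl | rfl | rfl | rfl | rfl <;> simp_all
    rw [e4] at hsc
    have h4 : p % 4 = 3 := by omega
    rw [if_pos h6, mul_one, ZMod.χ₄_nat_three_mod_four h4]
  · have h3 : p % 3 ≠ 1 := by
      intro h3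
      rcases ha with rfl | rfl | rfl | rfl | rfl | rfl <;> simp_all <;> omega
    rw [if_neg h6, if_neg h3, ← mul_assoc, hχ₄]
    norm_num

/-- **… and potentially good principal-series type (`e ∣ p − 1`), one inert prime, ANY `M` ⟹ sign `+1`.** Conditional on {hmod, F1 at `p`}.
[cite: Rohrlich1993Compositio, Prop. 2(iv)] [cite: KellockDokchitser2023, Rem. 2.2] -/
theorem rootNumber_mul_rootNumber_ramifiedTwist_of_one_inert_anyLevel_eq_one_of_dvd (W : WeierstrassCurve ℚ) [W.IsElliptic]
    (hmod : exists_isNewformOf) (hF1 : W.atkinLehnerEigenvalueAt_eq_localRootNumberAt)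
    (hF1' : (W.quadraticTwist (((-1 : ℤ) ^ (p / 2) * p : ℤ) : ℚ)).atkinLehnerEigenvalueAt_eq_localRootNumberAt)
    (hp5 : 5 ≤ p) {M : ℕ} (hN : W.conductorNorm ℤ = M * p ^ 2) (hpM : ¬ p ∣ M) {a : ℕ}
    (hΔ : addVal ℤ_[p] (((W.baseChange ℚ_[p]).minimal ℤ_[p]).integralModel ℤ_[p]).Δ = a)
    (ha : a = 2 ∨ a = 3 ∨ a = 4 ∨ a = 8 ∨ a = 9 ∨ a = 10)
    (hc₄ : addVal ℤ_[p] (((W.baseChange ℚ_[p]).minimal ℤ_[p]).integralModel ℤ_[p]).c₄ ≠ 0)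
    (hj : ¬ 3 * addVal ℤ_[p] (((W.baseChange ℚ_[p]).minimal ℤ_[p]).integralModel ℤ_[p]).c₄ <
      addVal ℤ_[p] (((W.baseChange ℚ_[p]).minimal ℤ_[p]).integralModel ℤ_[p]).Δ)
    {d' : ℤ} (hd'4 : d' % 4 = 1) (hd'sq : Squarefree d') (hgcd : Int.gcd d' (W.conductorNorm ℤ) = 1)
    (hneg : (-1 : ℤ) ^ (p / 2) * p * d' < 0)
    {q₀ : ℕ} (hq₀ : q₀ ∈ M.primeFactors) (hq₀2 : q₀ ≠ 2) (hodd₀ : Odd (M.factorization q₀))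
    (hinert : J((-1 : ℤ) ^ (p / 2) * p * d' | q₀) = -1)
    (hodd : ∀ q ∈ M.primeFactors, q ≠ q₀ → q ≠ 2 → J((-1 : ℤ) ^ (p / 2) * p * d' | q) = 1)
    (htwo : 2 ∣ M → ((-1 : ℤ) ^ (p / 2) * p * d') % 8 = 1)
    (hps : 12 / Nat.gcd a 12 ∣ p - 1) :
    W.rootNumber * (W.quadraticTwist (((-1 : ℤ) ^ (p / 2) * p * d' : ℤ) : ℚ)).rootNumber = 1 := by
  have hp2 : p ≠ 2 := by omega
  obtain ⟨hadd, hadd', hprod⟩ := localRootNumber_mul_pStarTwist_padic_of_mem W hp5 hΔ ha hc₄ hj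
  rw [rootNumber_mul_rootNumber_ramifiedTwist_of_localData_of_one_inert_anyLevel W hmod hF1 hF1' hp5 hN hpM hadd hadd' hprod hd'4 hd'sq
    hgcd hneg hq₀ hq₀2 hodd₀ hinert hodd htwo]
  have hp' := (Nat.Prime.eq_two_or_odd (Fact.out : p.Prime)).resolve_left hp2
  have hχ₄ := χ₄_mul_self_of_ne_two (p := p) hp2
  by_cases h6 : a % 6 = 3
  · have e4 : 12 / Nat.gcd a 12 = 4 := by
      rcases ha with rfl | rfl | rfl | rfl | rfl | rfl <;> simp_all
    rw [e4] at hps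
    have h4 : p % 4 = 1 := by omega
    rw [if_pos h6, mul_one, ZMod.χ₄_nat_one_mod_four h4]
  · have h3 : p % 3 = 1 := by
      rcases ha with rfl | rfl | rfl | rfl | rfl | rfl <;> simp_all <;> omega
    rw [if_neg h6, if_pos h3, ← mul_assoc, hχ₄, one_mul]

end Inert

end Summit.BirchSwinnertonDyer.BirchSwinnertonDyer.Theorems.AdditiveKoly.RamifiedHabitat

end
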